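import Summits.BirchSwinnertonDyer.BirchSwinnertonDyer.Theorems.BiquadraticEisensteinDescentHeegnerTwistCouplingInSupplyDisjointDivisibility
import HarnessLib

set_option linter.dupNamespace false -- `Summit.BirchSwinnertonDyer.BirchSwinnertonDyer.Theorems.…` (summit = sub)
set_option autoImplicit false

/-!
# Route `BiquadraticEisensteinDescent`, crux `HeegnerTwistCouplingInSupply` (stmt-BirchSwinnertonDyer-21381) —
# crux idea `disjoint-divisibility-pigeonhole`: currency extras

Cell `pub/bsd-wall`, width-prover seat `bsd-wall-cm-bed-w4` g24 (explicit-unit, `--supports stmt-BirchSwinnertonDyer-21381`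
as helper). Companion of `…HeegnerTwistCouplingInSupplyDisjointDivisibility.lean` (glue + door); objects in
`…DisjointDivisibilityDefs.lean`. Three small items kept out of the main file for length:

* `filter_dvd_subset_divisibleIn` — the converse inclusion `{d ∈ A_N(Y) : p ∣ h(d)} ⊆ S_p ∩ A_N(Y)`, so that
  `divisibleIn N Y p = (ambient N Y).filter (p ∣ h ·)` (`divisibleIn_eq_filter_dvd`): the card's `S_p` IS a divisibility class
  of the integer-valued function `d ↦ h(d)`;
* `exists_isCouplingDisc_of_card_lt` — `pigeonholeTransfer` with the shape's binders explicit, for consumers;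
* **`not_exceptionalSetShape_literal`** — the sketch's hypothesis-free `exceptionalSetShape` is FALSE as typed (triage datum):
  on an EMPTY ambient set every prime is vacuously `τ`-popular (`τ·0 ≤ 0`); witness `N₀ = 1, Y = 2, P = 10, τ = 1` (the four
  primes `11, 13, 17, 19` are popular while `log 2/log 10 + 1 < 2`). The corrected statement is the main file's
  `card_popular_le_log` (hypothesis `(ambient N₀ Y).Nonempty`).

Nothing here bears on the truth of the crux; BSD is not proved; stmt-21381 is not closed.
-/

noncomputable section

open scoped Classical

open Literature.NumberTheory.EllipticCurves Literature.NumberTheory.QuadraticFields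

namespace Summit.BirchSwinnertonDyer.BirchSwinnertonDyer.Theorems.DisjointDivisibility

/-- `{d ∈ A_N(Y) : p ∣ h(d)} ⊆ S_p ∩ A_N(Y)` (the converse inclusion, for the record). [folklore] -/
theorem filter_dvd_subset_divisibleIn (N Y p : ℕ) :
    (ambient N Y).filter (fun d => p ∣ BinaryQuadraticForm.classNumber d) ⊆ divisibleIn N Y p := by
  intro d hd
  rw [Finset.mem_filter] at hd
  rw [divisibleIn, Finset.mem_filter]
  refine ⟨hd.1, ?_⟩
  obtain ⟨K, hF, hNF, hK, hdK, -, -⟩ := (mem_ambient.1 hd.1).2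
  exact @isDivisibleDisc_of_dvd_formClassNumber p d K hF hNF hK hdK hd.2

/-- Unfolded form of `pigeonholeTransfer` (same statement with the shape's binders explicit), for consumers. [folklore] -/
theorem exists_isCouplingDisc_of_card_lt {A B : ℕ} (hS1 : LevelUniformNonvanishingCount A B)
    (W : WeierstrassCurve ℚ) [W.IsElliptic] [W.IsGloballyMinimal] [NeZero (W.conductorNorm ℤ)]
    (p N₀ Y : ℕ) (hCM : W.HasCM) (hr : W.analyticRank = 1) (hY : (W.conductorNorm ℤ) ^ A ≤ Y)
    (hsub : ambient (W.conductorNorm ℤ) Y ⊆ ambient N₀ Y)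
    (hlt : ((divisibleIn N₀ Y p).card : ℝ) <
      ((ambient (W.conductorNorm ℤ) Y).card : ℝ) / (Real.log Y) ^ B) :
    ∃ d : ℤ, IsCouplingDisc W p d :=
  pigeonholeTransfer A B hS1 W p N₀ Y hCM hr hY (fun _ hd => hsub hd) hlt

/-- **The sketch's hypothesis-free `exceptionalSetShape` is FALSE as typed** (triage datum for the card): on an EMPTY
ambient set every prime is vacuously `τ`-popular (`τ·0 ≤ 0`), so at `N₀ = 1`, `Y = 2` (`A₁(2) = ∅`), `P = 10`, `τ = 1` the
four primes `11, 13, 17, 19` are popular while `log 2/log 10 + 1 < 2`. The corrected statement is `card_popular_le_log`.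
[folklore] -/
theorem not_exceptionalSetShape_literal :
    ¬ (∀ (N₀ Y P : ℕ) (τ : ℝ), 2 ≤ P → 2 ≤ Y → 0 < τ →
      ((((Finset.Icc P (2 * P)).filter Nat.Prime).filter (fun p => Popular N₀ Y p τ)).card : ℝ)
        ≤ (Real.log Y / Real.log P + 1) / τ) := by
  intro h
  have h1 := h 1 2 10 1 (by norm_num) le_rfl one_pos
  have hA : ambient 1 2 = ∅ := by
    rw [ambient, Finset.filter_eq_empty_iff]
    intro d hd
    rw [Finset.mem_Icc] at hd
    omega
  have hpop : ∀ p : ℕ, Popular 1 2 p 1 := by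
    intro p
    simp [Popular, divisibleIn, hA]
  have hcard : (((Finset.Icc 10 (2 * 10)).filter Nat.Prime).filter (fun p => Popular 1 2 p 1)).card = 4 := by
    rw [Finset.filter_true_of_mem (fun p _ => hpop p)]
    decide
  rw [hcard] at h1
  have hlog : Real.log (2 : ℕ) / Real.log (10 : ℕ) < 1 := by
    rw [div_lt_one (Real.log_pos (by norm_num))]
    exact Real.log_lt_log (by norm_num) (by norm_num)
  norm_num at h1
  linarith


/-- `S_p ∩ A_N(Y) = {d ∈ A_N(Y) : p ∣ h(d)}`: on the ambient set the card's divisibility class is the divisibility class of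
the integer `h(d)` (form class number). [folklore] -/
theorem divisibleIn_eq_filter_dvd (N Y p : ℕ) :
    divisibleIn N Y p = (ambient N Y).filter (fun d => p ∣ BinaryQuadraticForm.classNumber d) :=
  Finset.Subset.antisymm (divisibleIn_subset_filter_dvd N Y p) (filter_dvd_subset_divisibleIn N Y p)

end Summit.BirchSwinnertonDyer.BirchSwinnertonDyer.Theorems.DisjointDivisibility

end
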